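import Summits.QuantumAdvantage.QuantumAdvantage.Theorems.AnchorDialSetTable

/-!
# AnchorDial — part 18/18 «SetWindow» (cell decomp-qadv, seat lens-2, generation 14 rev 9; supports item 26531 `ExactnessDial.PolyLossOddU3`)

§12j of the node (rev 9), second half: THE SET-WINDOW LAW **`windowSet_loss r c`** (part 15's `windowDev_loss` WITHOUT
the one-deviation-point hypothesis: polylog strategy + polylog a.e.-unique flip-stable anchor with the WHOLE deviation set
in `[k(x), k(x)+r]` a.e. ⟹ loses `≥ 2^{n-1}/49`, `n ≥ max n₀ 2^{5r+6}`; proof = part 14's `value_certificate_loss (c+1)` +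
part 17's `cwt_gS_of_rel`), its tightness `windowSet_loss_needs_degree` (from part 16's witness), the classes `SAnchorable r c`
(`sAnchorable_of_wAnchorable`, `sAnchorable_mono`), the re-typed residual **`NoSetAnchorLoss3`** (= `T` on coarsely
delocalised strategies), `noSetAnchorLoss3_of_polyLossOddU3`, `noSetAnchorLoss3_of_noWindowAnchorLoss3`,
**`polyLossOddU3_of_noSetAnchorLoss3`** (dichotomy at width `r = c`), **`polyLossOddU3_iff_noSetAnchorLoss3`**,
**`closes_noSetAnchor : NoSetAnchorLoss3 → DPLift3 → AdviceFreeQNC0Three`** (BY NAME via `HolonomyDial.closes_T`).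
Verbatim from the node file (rev 9; `HolonomyDial.card_odd_le` qualified as in the landed parts); namespace
`…Theorems.AnchorDial`; imports part 17; joint check `tree/Tail12to18.check.lean`; record NODE-g14.md §REV 9.  Prop defs
(`SAnchorable`, `NoSetAnchorLoss3`) are statements of the node: `NoSetAnchorLoss3` is the typed residual (≡ 26531), not a crux.
-/

set_option linter.dupNamespace false

noncomputable section

open scoped Classical

namespace Summit.QuantumAdvantage.QuantumAdvantage.Theorems.AnchorDial

open Finset
open Literature.Computability.QuantumComplexity Literature.Computability.QuantumComplexity.RingHLF
open Literature.Computability.MetaComplexity Literature.Computability.MetaComplexity.Smolensky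
open Summit.QuantumAdvantage.AdviceFreeQNC0
open Summit.QuantumAdvantage.QuantumAdvantage.Theses (ExactnessDial.PolyLossOddU3 ExactnessDial.DPLift3)
open Summit.QuantumAdvantage.QuantumAdvantage.Theorems.HolonomyDial (gCond tPoly tPoly_mem tPoly_apply selP selP_mem
  selP_apply xorP xorP_mem xorP_apply_bool closes_T)

variable {N : ℕ}

section SetWindow

/-- **THE SET-WINDOW LAW** (`windowSet_loss r c`, rev 9): a degree-`(log₂ n)^c` strategy whose deviation SET (any
number of points, possibly empty) lies, a.e., inside the window `[k(x), k(x) + r]` over a degree-`(log₂ n)^c`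
anchor family that is a.e. unique (UNIQ) and flip-stable on average (STAB) LOSES on at least `2^{n-1}/49` odd
inputs, `n ≥ max n₀(c+1) 2^{5r+6}`.  `windowDev_loss` is the sub-case of one-point deviation sets; its hypothesis
UNI is superfluous.  Proof: `value_certificate_loss (c+1)` for the table certificate `(A, gS P r)` + `cwt_gS_of_rel`. -/
theorem windowSet_loss (r c : ℕ) : ∃ n₀ : ℕ, ∀ n ≥ n₀, ∀ P A : Fin n → CubeFn (ZMod 3) n,
    (∀ i, P i ∈ lowDeg (ZMod 3) n ((Nat.log 2 n) ^ c)) → (∀ k, A k ∈ lowDeg (ZMod 3) n ((Nat.log 2 n) ^ c)) →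
    4096 * (univ.filter fun x : Fin n → Bool =>
        OddZeros x ∧ (univ.filter fun k : Fin n => A k x = 1).card ≠ 1).card ≤ 2 ^ (n - 1) →
    4096 * (∑ a ∈ range n, (univ.filter fun x : Fin n → Bool =>
        OddZeros x ∧ ∃ k : Fin n, ¬ ((A k (flip2 a (a + 1) x) = 1) ↔ (A k x = 1))).card) ≤ n * 2 ^ (n - 1) →
    4096 * (univ.filter fun x : Fin n → Bool => OddZeros x ∧
        ¬ ∃ k : Fin n, A k x = 1 ∧ ∀ i ∈ dev P x, k.val ≤ i.val ∧ i.val ≤ k.val + r).card ≤ 2 ^ (n - 1) →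
      2 ^ (n - 1) ≤ 49 * (univ.filter fun x : Fin n → Bool =>
        OddZeros x ∧ ¬ Rel x (fun i => decide (P i x = 1))).card := by
  obtain ⟨n₀, hn₀⟩ := value_certificate_loss (c + 1)
  refine ⟨max n₀ (2 ^ (5 * r + 6)), fun n hn P A hP hA hU hS hN => ?_⟩
  have hnr : 2 ^ (5 * r + 6) ≤ n := le_trans (le_max_right _ _) hn
  have hn64 : 64 ≤ n := by
    have h64 : (64 : ℕ) ≤ 2 ^ (5 * r + 6) := by
      rw [show (64 : ℕ) = 2 ^ 6 by norm_num]
      exact Nat.pow_le_pow_right (by norm_num) (by omega)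
    omega
  have hbump := deg_bump_set n c r hnr
  have hLpos : 1 ≤ Nat.log 2 n := le_trans (by omega) (Nat.le_log_of_pow_le (by norm_num) hnr)
  have hmono : (Nat.log 2 n) ^ c ≤ (Nat.log 2 n) ^ (c + 1) := Nat.pow_le_pow_right hLpos (by omega)
  have hA' : ∀ k, A k ∈ lowDeg (ZMod 3) n ((Nat.log 2 n) ^ (c + 1)) := fun k =>
    lowDeg_mono hmono (hA k)
  have hg' : ∀ k, gS P r k ∈ lowDeg (ZMod 3) n ((Nat.log 2 n) ^ (c + 1)) := fun k =>
    lowDeg_mono hbump (gS_mem hP r k)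
  have key := hn₀ n (le_trans (le_max_left _ _) hn) A (gS P r) hA' hg' hU hS
  set SU := univ.filter fun x : Fin n → Bool =>
    OddZeros x ∧ (univ.filter fun k : Fin n => A k x = 1).card ≠ 1 with hSU
  set SN := univ.filter fun x : Fin n → Bool => OddZeros x ∧
    ¬ ∃ k : Fin n, A k x = 1 ∧ ∀ i ∈ dev P x, k.val ≤ i.val ∧ i.val ≤ k.val + r with hSN
  set SL := univ.filter fun x : Fin n → Bool => OddZeros x ∧ ¬ Rel x (fun i => decide (P i x = 1)) with hSL
  have hsub : (univ.filter fun x : Fin n → Bool => OddZeros x ∧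
      ¬ ∃ k : Fin n, (univ.filter fun k' : Fin n => A k' x = 1) = {k} ∧
        ((cN x k.val : ℕ) : ZMod 3) ≠ (if zpar x (k.val + 1) = true then 1 - gS P r k x else gS P r k x))
      ⊆ (SU ∪ SN) ∪ SL := by
    intro x hx
    rw [mem_filter] at hx
    obtain ⟨-, hodd, hno⟩ := hx
    by_cases h1 : (univ.filter fun k : Fin n => A k x = 1).card = 1
    swap
    · exact mem_union_left _ (mem_union_left _ (mem_filter.2 ⟨mem_univ _, hodd, h1⟩))
    by_cases h3 : ∃ k : Fin n, A k x = 1 ∧ ∀ i ∈ dev P x, k.val ≤ i.val ∧ i.val ≤ k.val + r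
    swap
    · exact mem_union_left _ (mem_union_right _ (mem_filter.2 ⟨mem_univ _, hodd, h3⟩))
    refine mem_union_right _ (mem_filter.2 ⟨mem_univ _, hodd, fun hrel => hno ?_⟩)
    obtain ⟨k₀, hk₀⟩ := card_eq_one.1 h1
    obtain ⟨k, hkA, hnear⟩ := h3
    have hkk : k = k₀ := by
      have hmem : k ∈ (univ.filter fun k : Fin n => A k x = 1) := mem_filter.2 ⟨mem_univ _, hkA⟩
      rw [hk₀, mem_singleton] at hmem
      exact hmem
    subst hkk
    exact cwt_gS_of_rel (by omega) P A r x hodd k hk₀ hnear hrel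
  have hcard := card_le_card hsub
  have hu1 := card_union_le (SU ∪ SN) SL
  have hu2 := card_union_le SU SN
  omega

/-- degree is necessary in `windowSet_loss` for every `r ≥ 1` (the §12h witness; corollary of
`windowDev_loss_needs_degree`). -/
theorem windowSet_loss_needs_degree (hN : 3 ≤ N) {r : ℕ} (hr : 1 ≤ r) :
    ∃ P A : Fin N → CubeFn (ZMod 3) N,
      (∀ k, A k ∈ lowDeg (ZMod 3) N 0) ∧
      (univ.filter fun x : Fin N → Bool =>
          OddZeros x ∧ (univ.filter fun k : Fin N => A k x = 1).card ≠ 1) = ∅ ∧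
      (∀ a : ℕ, (univ.filter fun x : Fin N → Bool =>
          OddZeros x ∧ ∃ k : Fin N, ¬ ((A k (flip2 a (a + 1) x) = 1) ↔ (A k x = 1))) = ∅) ∧
      (univ.filter fun x : Fin N → Bool => OddZeros x ∧
          ¬ ∃ k : Fin N, A k x = 1 ∧ ∀ i ∈ dev P x, k.val ≤ i.val ∧ i.val ≤ k.val + r) = ∅ ∧
      (univ.filter fun x : Fin N → Bool => OddZeros x ∧ ¬ Rel x (fun i => decide (P i x = 1))) = ∅ := by
  obtain ⟨P, A, h0, h1, h2, -, h4, h5⟩ := windowDev_loss_needs_degree hN hr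
  exact ⟨P, A, h0, h1, h2, h4, h5⟩

/-- SET-ANCHORABLE at width `r`, degree budget `(log₂ N)^c`: the hypotheses of `windowSet_loss` — a declarable
coarse anchor confining the whole deviation SET to a window of width `r`, a.e. -/
def SAnchorable (r c : ℕ) (P : Fin N → CubeFn (ZMod 3) N) : Prop :=
  ∃ A : Fin N → CubeFn (ZMod 3) N, (∀ k, A k ∈ lowDeg (ZMod 3) N ((Nat.log 2 N) ^ c)) ∧
    4096 * (univ.filter fun x : Fin N → Bool =>
        OddZeros x ∧ (univ.filter fun k : Fin N => A k x = 1).card ≠ 1).card ≤ 2 ^ (N - 1) ∧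
    4096 * (∑ a ∈ range N, (univ.filter fun x : Fin N → Bool =>
        OddZeros x ∧ ∃ k : Fin N, ¬ ((A k (flip2 a (a + 1) x) = 1) ↔ (A k x = 1))).card) ≤ N * 2 ^ (N - 1) ∧
    4096 * (univ.filter fun x : Fin N → Bool => OddZeros x ∧
        ¬ ∃ k : Fin N, A k x = 1 ∧ ∀ i ∈ dev P x, k.val ≤ i.val ∧ i.val ≤ k.val + r).card ≤ 2 ^ (N - 1)

/-- AnchorDialSetWindow helper `sAnchorable_of_wAnchorable` (decomp-qadv land package; see the module docstring). -/
theorem sAnchorable_of_wAnchorable {r c : ℕ} {P : Fin N → CubeFn (ZMod 3) N} (h : WAnchorable r c P) :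
    SAnchorable r c P := by
  obtain ⟨A, hA, hU, hS, -, hN⟩ := h
  exact ⟨A, hA, hU, hS, hN⟩

/-- AnchorDialSetWindow helper `sAnchorable_mono` (decomp-qadv land package; see the module docstring). -/
theorem sAnchorable_mono {r r' c : ℕ} (hr : r ≤ r') {P : Fin N → CubeFn (ZMod 3) N} (h : SAnchorable r c P) :
    SAnchorable r' c P := by
  obtain ⟨A, hA, hU, hS, hN⟩ := h
  refine ⟨A, hA, hU, hS, le_trans (Nat.mul_le_mul_left _ (card_le_card fun x hx => ?_)) hN⟩
  rw [mem_filter] at hx ⊢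
  refine ⟨hx.1, hx.2.1, fun ⟨k, hk, hnear⟩ => hx.2.2 ⟨k, hk, fun i hi => ?_⟩⟩
  have h := hnear i hi
  omega

/-- **PIECE (typed residual, rev 9) `NoSetAnchorLoss3` — `T` RESTRICTED TO COARSELY DELOCALISED STRATEGIES**: those
whose deviation set admits, for the given width `r` and degree budget `c`, NO declarable coarse anchor confining it
to a window a.e.  `≡ T` (`polyLossOddU3_iff_noSetAnchorLoss3`); the excluded classes `SAnchorable r c` (all `r`,
multi-point deviation sets included) are settled by `windowSet_loss`.  IDEA-NEEDED; BARRIER-ADJACENT (small-set /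
relative Smolensky: the coarse LOCATION of the bet must itself be undeclarable in polylog degree). -/
def NoSetAnchorLoss3 : Prop :=
  ∃ C : ℕ, ∀ c r : ℕ, ∃ n₀ : ℕ, ∀ n ≥ n₀, ∀ P : Fin n → CubeFn (ZMod 3) n,
    (∀ i, P i ∈ lowDeg (ZMod 3) n ((Nat.log 2 n) ^ c)) → ¬ SAnchorable r c P →
      ((univ.filter fun x : Fin n → Bool => OddZeros x ∧ Rel x (fun i => decide (P i x = 1))).card : ℝ) ≤
        (1 - 1 / (n : ℝ) ^ C) * (2 : ℝ) ^ (n - 1)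

/-- AnchorDialSetWindow helper `noSetAnchorLoss3_of_polyLossOddU3` (decomp-qadv land package; see the module docstring). -/
theorem noSetAnchorLoss3_of_polyLossOddU3 (h : ExactnessDial.PolyLossOddU3) : NoSetAnchorLoss3 := by
  obtain ⟨C, hC⟩ := h
  refine ⟨C, fun c _ => ?_⟩
  obtain ⟨n₀, hn₀⟩ := hC c
  exact ⟨n₀, fun n hn P hP _ => hn₀ n hn P hP⟩

/-- the rev-9 residual class is contained in the rev-8 one. -/
theorem noSetAnchorLoss3_of_noWindowAnchorLoss3 (h : NoWindowAnchorLoss3) : NoSetAnchorLoss3 := by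
  obtain ⟨C, hC⟩ := h
  refine ⟨C, fun c r => ?_⟩
  obtain ⟨n₀, hn₀⟩ := hC c r
  exact ⟨n₀, fun n hn P hP hc => hn₀ n hn P hP fun hw => hc (sAnchorable_of_wAnchorable hw)⟩

/-- **dichotomy, rev 9: `NoSetAnchorLoss3 → T`** — set-anchorable strategies (at width `r = c`) by `windowSet_loss`,
the rest by the residual. -/
theorem polyLossOddU3_of_noSetAnchorLoss3 (h : NoSetAnchorLoss3) : ExactnessDial.PolyLossOddU3 := by
  obtain ⟨C, hR⟩ := h
  refine ⟨max C 1, fun c => ?_⟩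
  obtain ⟨n₁, hn₁⟩ := hR c c
  obtain ⟨n₂, hn₂⟩ := windowSet_loss c c
  refine ⟨max (max n₁ n₂) 49, fun n hn P hP => ?_⟩
  have hn1 : n₁ ≤ n := le_trans (le_trans (le_max_left _ _) (le_max_left _ _)) hn
  have hn2 : n₂ ≤ n := le_trans (le_trans (le_max_right _ _) (le_max_left _ _)) hn
  have hn49 : 49 ≤ n := le_trans (le_max_right _ _) hn
  have hP0 : (0 : ℝ) ≤ (2 : ℝ) ^ (n - 1) := by positivity
  by_cases hc : SAnchorable c c P
  · obtain ⟨A, hA, hU, hS, hN⟩ := hc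
    have hL := hn₂ n hn2 P A hP hA hU hS hN
    have hWL := Finset.card_filter_add_card_filter_not
      (s := (univ : Finset (Fin n → Bool)).filter fun x => OddZeros x)
      (fun x => Rel x (fun i => decide (P i x = 1)))
    rw [filter_filter, filter_filter] at hWL
    have hO' := HolonomyDial.card_odd_le (n := n) (by omega)
    have h48 : 49 * (univ.filter fun x : Fin n → Bool =>
        OddZeros x ∧ Rel x (fun i => decide (P i x = 1))).card ≤ 48 * 2 ^ (n - 1) := by omega
    have hfin : n * (univ.filter fun x : Fin n → Bool =>
        OddZeros x ∧ Rel x (fun i => decide (P i x = 1))).card + 2 ^ (n - 1) ≤ n * 2 ^ (n - 1) := by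
      have h1 := Nat.mul_le_mul_left n h48
      rw [Nat.mul_left_comm n 49, Nat.mul_left_comm n 48] at h1
      have h2 := Nat.mul_le_mul_right (2 ^ (n - 1)) hn49
      omega
    have hreal := real_tail n _ (2 ^ (n - 1)) (by omega) hfin
    push_cast at hreal
    exact loss_shape_mono (by omega) (le_max_right C 1) _ _ hP0 hreal
  · exact loss_shape_mono (by omega) (le_max_left C 1) _ _ hP0 (hn₁ n hn1 P hP hc)

/-- **NODE EQUATION, rev 9**: `T ⟺ NoSetAnchorLoss3`. -/
theorem polyLossOddU3_iff_noSetAnchorLoss3 : ExactnessDial.PolyLossOddU3 ↔ NoSetAnchorLoss3 :=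
  ⟨noSetAnchorLoss3_of_polyLossOddU3, polyLossOddU3_of_noSetAnchorLoss3⟩

/-- `closes` through the rev-9 residual. -/
theorem closes_noSetAnchor (hR : NoSetAnchorLoss3) (hD : ExactnessDial.DPLift3) : AdviceFreeQNC0Three :=
  closes_T (polyLossOddU3_of_noSetAnchorLoss3 hR) hD

end SetWindow

end Summit.QuantumAdvantage.QuantumAdvantage.Theorems.AnchorDial

end
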